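import Summits.HodgeConjecture.HodgeConjecture.Theorems.F0P3cStCharTSHtrAtReps                -- ★ (F0P2-p06) «HTR-AT-REPS»: the binder texts `hlev hχlev hK₁χ` ∕ `(hfd h2 ℓ hℓ1 hL hQ hiff)` this file serves (brings ★ ST-SHELL-TRACE's cone)
import Summits.HodgeConjecture.HodgeConjecture.Theorems.F0P3cU2PrincipalSeriesJacquetFiltration  -- ★ W2-c (LH5-p05): `u2PrincipalSeries_jacquetFiltration`
import Summits.HodgeConjecture.HodgeConjecture.Theorems.F0P3cStCharTSDomGeneralH              -- ★ p849946 (LH1-p03): `hiff_of_weylConj₂`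
import Summits.HodgeConjecture.HodgeConjecture.Theorems.F0P3cStCharTSXiCont                   -- ★ p850203 (F0P3-p01): `continuous_unitsHom_of_continuous_val`
import Summits.HodgeConjecture.HodgeConjecture.Theorems.F0P3cStCharTSCharTrivialNhds           -- ★ p849929 (LH6-p04): `exists_nhds_forall_apply_eq_one`, `exists_nhds_forall_subtype_apply_eq_one`
import Literature.NumberTheory.Rogawski1990.XiLocalCharacter                                   -- ★ `continuous_xiLocalChar`
import Literature.NumberTheory.Automorphic.CMLocalRingModulusContinuous                        -- ★ `continuous_halfModulusChar_apply`, `continuous_mul_comp_quotConj_apply` pattern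
import Literature.NumberTheory.Automorphic.SmoothIndClosedCellNonzero                          -- ★ `NonarchimedeanGroup.subgroup`
import HarnessLib

/-!
# F0 · P3c · line LH6 «StCharTS» — road (D), «JACQUET-DATUM-H ∕ H-LEVEL-DEEP★»: the by-shape inputs of ★ ST-SHELL-TRACE ∕ ★ «HTR-AT-REPS» ∕ «VALUE-AT-FLIPS» DISCHARGED at
# the head's own H-datum — (J3) a DEEP level `n′` and a SMALL `K₁′` with `ξ_v = 1` on `K_{2,n′} × K₁′`, `χ_{H,2} = 1` on `T₂ ∩ K_{2,n′}`, `ψ_v∘det = 1` on `K₁′`, refining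
# LEVEL-PICK's `(n′₀, K₁)`; (J1) the normalised 2-step Jacquet datum of `i₂(χ_{H,2})` (★ W2-c); (J2) F1-H's `hiff` at every level (★ p849946)
# [Rogawski1990, §12.1–12.2 pp. 171–174; §12.7 L. 12.7.3 (proof) p. 195; Casselman1995, Prop. 1.4.4]

Cell `pub/hodgecm-mathlib`, crux H413 = `stmt-HodgeConjecture-24833` (lane `--supports … --as helper`), route HCCMUnconditional; seat A-p16 (g34), «HEAD-DRAFT-A» co-pilot; road (D)
owner LH6-p04 (g3) deal «JACQUET-DATUM-H★» 2026-09-02T07:57:00Z (5).  THEOREMS ONLY (no definition, no instance, no notation, no named fact, no `sorry`); ★-only imports.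
HONEST LABEL: HC_CM is proved only modulo the 7 printed citations (2 remaining: hLiu418 = stmt-HodgeConjecture-24832, h413 = stmt-HodgeConjecture-24833) until rung 0 closes;
count-neutral plumbing of road (D).

THE MATHEMATICS.  (J3, generic §1) `G₂, G₁` topological groups, `G₁` non-archimedean, `𝓘₂` an Iwahori datum of a parabolic triple of `G₂` (levels `K n`, a neighbourhood basis of `1`,
★ `IwahoriDatum.hasBasis_K`), `K₁ ≤ G₁` compact open, and three «trivialising neighbourhoods»: `Vχ ∈ 𝓝 1` in `G₂ × G₁` on which `χ = 1`, `W ∈ 𝓝 1` in `G₂` on which `θ|_{T₂} = 1`,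
`Vψ ∈ 𝓝 1` in `G₁` on which `ψd = 1`.  Then some level `n′` and some compact open subgroup `K₁′ ≤ K₁` satisfy `K n′ ≤ K n₀`, `χ = 1` on `K n′ × K₁′`, `ψd = 1` on `K₁′`, `θ = 1`
on `T₂ ∩ K n′`: split `Vχ ⊇ V₂ ×ˢ V₁` (`mem_nhds_prod_iff`), take `n′` with `K n′ ⊆ V₂ ∩ W ∩ K n₀` (`hasBasis_K`; `K n₀` is open ∋ 1 — no monotonicity of the levels needed) and
`K₁′ := K₁ ⊓ V` for an open subgroup `V ⊆ V₁ ∩ Vψ` (`NonarchimedeanGroup.is_nonarchimedean`).  (§2, CM) the three neighbourhoods at `χ := ξ_v` (★ `continuous_xiLocalChar` +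
★ `exists_nhds_forall_apply_eq_one` on the non-archimedean `U(Φ₂)_v × U(Φ₁)_v`), `θ := χ_{H,2} = torusCharPair … 0 ((η_v∘quotConj)·‖·‖^{1∕2}) ψ_v` (★ continuity + ★
`exists_nhds_forall_subtype_apply_eq_one` on `T₂`, non-archimedean by ★ `NonarchimedeanGroup.subgroup`), `ψd := ψ_v ∘ det` (its open kernel `hψo`, the hypothesis the whole
ST-SHELL-TRACE chain carries) — giving `hlev ∕ hχlev ∕ hK₁χ` in the binder texts of ★ `htr_at_reps` VERBATIM, together with the BOX∕PICK inheritance to the refined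
`S′ := (K_{2,n′} ∩ T₂) × K₁′` (★ p850088's `∀ k ∈ S′` antecedent holds since `K n′ ≤ K n₀`, `K₁′ ≤ K₁`).  (J1) = ★ W2-c `u2PrincipalSeries_jacquetFiltration L v hns _ _ (continuous_chiH2_fst L v ξ) (continuous_torusLocalComponent …)` in the head
(one line; the continuity of the first coordinate `continuous_chiH2_fst` is the only new piece, here).  (J2) ★ `hiff_of_weylConj₂` with ★ `torusCharPair_cm_weylConj_two`.

## References
* [Rogawski1990] J. D. Rogawski, *Automorphic Representations of Unitary Groups in Three Variables*, Ann. of Math. Stud. 123 (1990): §12.1 case (1) pp. 171–172; §12.2 (2)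
  p. 174; §12.7 Lemma 12.7.3 (proof) p. 195; §4.3 (4.3.1) p. 43.
* [Casselman1995] W. Casselman, *Introduction to the theory of admissible representations of 𝔭-adic reductive groups* (1995 notes), §1.4 Prop. 1.4.4 p. 14; Thm. 3.3.3.
* [TateThesis1967] J. Tate, *Fourier analysis in number fields and Hecke's zeta-functions* (1967), §2.3 (continuous quasi-characters are trivial near `1`).
-/

set_option autoImplicit false
-- the mandated namespace has the single-problem summit's repeated segment (`HodgeConjecture.HodgeConjecture`)
set_option linter.dupNamespace false

noncomputable section

open NumberField IsDedekindDomain Topology Filter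
open scoped Matrix MatrixGroups Pointwise
open Literature.NumberTheory Literature.NumberTheory.Automorphic Literature.NumberTheory.Automorphic.UnitaryGroup
open Literature.NumberTheory.GaloisRepresentations
open Literature.NumberTheory.Rogawski1990

namespace Summit.HodgeConjecture.HodgeConjecture.Cruxes.H413.F0P3cStCharTSHLevelDeep

/-! ## §1 Generic: a deep level and a small compact open `K₁′` trivialising three characters -/

section Generic

/-- **«H-LEVEL-DEEP★», generic.**  For an Iwahori datum `𝓘₂` of a parabolic triple `t` of `G₂` (levels `K n` forming a neighbourhood basis of `1`), a compact open `K₁ ≤ G₁` (`G₁`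
non-archimedean), a start level `n₀`, and characters `χ` of `G₂ × G₁`, `θ` of `t.M`, `ψd` of `G₁` trivial on neighbourhoods of `1` (`Vχ`, `W` read on `t.M`, `Vψ`): there are a
level `n′` with `K n′ ≤ K n₀` and a compact open subgroup `K₁′ ≤ K₁` such that `χ = 1` on `K n′ × K₁′`, `ψd = 1` on `K₁′` and `θ = 1` on `T ∩ K n′`.  No monotonicity of the
levels is assumed (`K n₀` itself is one of the neighbourhoods shrunk into). [cite: Casselman1995, Prop. 1.4.4 p. 14] [cite: TateThesis1967, §2.3] -/
theorem exists_deep_level {G₂ G₁ : Type*} [Group G₂] [TopologicalSpace G₂] [Group G₁] [TopologicalSpace G₁] [NonarchimedeanGroup G₁]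
    (t : ParabolicTriple G₂) (𝓘₂ : t.IwahoriDatum) (n₀ : ℕ)
    (K₁ : Subgroup G₁) (hK₁o : IsOpen (K₁ : Set G₁)) (hK₁c : IsCompact (K₁ : Set G₁))
    (χ : G₂ × G₁ →* ℂˣ) {Vχ : Set (G₂ × G₁)} (hVχ : Vχ ∈ 𝓝 (1 : G₂ × G₁)) (hχ : ∀ x ∈ Vχ, χ x = 1)
    (θ : ↥t.M →* ℂˣ) {W : Set G₂} (hW : W ∈ 𝓝 (1 : G₂)) (hθ : ∀ k : ↥t.M, (k : G₂) ∈ W → θ k = 1)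
    (ψd : G₁ →* ℂˣ) {Vψ : Set G₁} (hVψ : Vψ ∈ 𝓝 (1 : G₁)) (hψ : ∀ k ∈ Vψ, ψd k = 1) :
    ∃ (n' : ℕ) (K₁' : Subgroup G₁), 𝓘₂.K n' ≤ 𝓘₂.K n₀ ∧ K₁' ≤ K₁ ∧ IsOpen (K₁' : Set G₁) ∧ IsCompact (K₁' : Set G₁) ∧
      (∀ x ∈ (𝓘₂.K n').prod K₁', χ x = 1) ∧ (∀ k ∈ K₁', ψd k = 1) ∧ (∀ k : ↥t.M, (k : G₂) ∈ 𝓘₂.K n' → θ k = 1) := by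
  -- split the product neighbourhood
  obtain ⟨V₂, hV₂, V₁, hV₁, hsub⟩ := mem_nhds_prod_iff.1 hVχ
  -- the deep level: `K n' ⊆ V₂ ∩ W ∩ K n₀`
  have hK₀ : ((𝓘₂.K n₀ : Subgroup G₂) : Set G₂) ∈ 𝓝 (1 : G₂) := (𝓘₂.isOpen_K n₀).mem_nhds (Subgroup.one_mem _)
  obtain ⟨n', hn'⟩ := 𝓘₂.hasBasis_K (V₂ ∩ W ∩ (𝓘₂.K n₀ : Set G₂)) (inter_mem (inter_mem hV₂ hW) hK₀)
  -- the small compact open `K₁' = K₁ ⊓ V`, `V` an open subgroup inside `V₁ ∩ Vψ`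
  obtain ⟨V, hV⟩ := NonarchimedeanGroup.is_nonarchimedean (V₁ ∩ Vψ) (inter_mem hV₁ hVψ)
  refine ⟨n', K₁ ⊓ (V : Subgroup G₁), fun x hx => (hn' hx).2, inf_le_left, ?_, ?_, ?_, ?_, ?_⟩
  · rw [Subgroup.coe_inf]
    exact hK₁o.inter V.isOpen
  · rw [Subgroup.coe_inf]
    exact hK₁c.inter_right V.isClosed
  · intro x hx
    obtain ⟨h₂, h₁⟩ := Subgroup.mem_prod.1 hx
    exact hχ x (hsub (Set.mk_mem_prod (hn' h₂).1.1 (hV (Subgroup.mem_inf.1 h₁).2).1))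
  · intro k hk
    exact hψ k (hV (Subgroup.mem_inf.1 hk).2).2
  · intro k hk
    exact hθ k (hn' hk).1.2

/-- **Inheritance of ★ LEVEL-PICK-INST's antecedent to the refined `S′`**: if every member of `S′ ≤ T × G₁` has `↑k.1 ∈ K n′` and `k.2 ∈ K₁′` with `K n′ ≤ K n₀`, `K₁′ ≤ K₁`, then every
member has `↑k.1 ∈ K n₀` and `k.2 ∈ K₁` — so ★ p850088's BOX∕PICK conclusions (stated `∀ S′` with this antecedent at `(n₀, K₁)`) apply to the deepened `S′` unchanged.
[cite: Casselman1995, Prop. 1.4.4 p. 14] -/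
theorem forall_mem_of_refine {G₂ G₁ : Type*} [Group G₂] [TopologicalSpace G₂] [Group G₁] (t : ParabolicTriple G₂) (𝓘₂ : t.IwahoriDatum)
    {n₀ n' : ℕ} {K₁ K₁' : Subgroup G₁}
    (hKle : 𝓘₂.K n' ≤ 𝓘₂.K n₀) (hK₁le : K₁' ≤ K₁) (S' : Subgroup (↥t.M × G₁))
    (hS' : ∀ k ∈ S', (k.1 : G₂) ∈ 𝓘₂.K n' ∧ k.2 ∈ K₁') :
    ∀ k ∈ S', (k.1 : G₂) ∈ 𝓘₂.K n₀ ∧ k.2 ∈ K₁ :=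
  fun k hk => ⟨hKle (hS' k hk).1, hK₁le (hS' k hk).2⟩

end Generic

/-! ## §2 The CM instance: `ξ_v`, `χ_{H,2}`, `ψ_v ∘ det` at the head's H-datum -/

section CM

variable (L : Type) [Field L] [NumberField L] [IsCMField L] (v : HeightOneSpectrum (𝓞 ↥(maximalRealSubfield L)))

/-- **The two coordinates of `χ_{H,2}` are continuous** (`(η_v ∘ quotConj)·‖·‖^{1∕2}` on `(∏ L_w)ˣ` and `ψ_v` on the norm-one units): the `h₁ h₂` inputs of ★ W2-c ∕ ★ F1-H at `χ_{H,2}`.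
(★ `continuous_torusLocalComponent`, ★ `continuous_quotConj`, ★ `continuous_halfModulusChar_apply`.) [cite: Rogawski1990, §12.2 (2) p. 174] [cite: TateThesis1967, §2.3] -/
theorem continuous_chiH2_fst (ξ : OneDimAutRepH L) :
    Continuous fun x : (LocalRing L v)ˣ =>
      ((((torusLocalComponent L (IsCMField.complexConj L) v ξ.η).comp
            (quotConj (conjLocal L (IsCMField.complexConj L) v) (conjLocal_conjLocal_cm L v)) *
          halfModulusChar (UnitaryGroup.LocalRing L v)) x : ℂˣ) : ℂ) := by
  have hη := continuous_torusLocalComponent L (IsCMField.complexConj L) (v := v) ξ.η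
  have hq := continuous_quotConj (conjLocal L (IsCMField.complexConj L) v) (conjLocal_conjLocal_cm L v) (continuous_conjLocal L (IsCMField.complexConj L) v)
  have hh := continuous_halfModulusChar_apply L v
  simp only [MonoidHom.mul_apply, MonoidHom.coe_comp, Function.comp_apply, Units.val_mul]
  exact (hη.comp hq).mul hh

/-- **(J2) F1-H's `hiff` at `χ_{H,2}` for the H-datum at every level**, from a Weyl element `w₂ ∈ K₀₂` (matrix `Φ₂`) and the normalising clause — texts of ★ `htr_at_reps` ∕ ★ F1-H
VERBATIM (★ p849946 `hiff_of_weylConj₂` with ★ `torusCharPair_cm_weylConj_two`). [cite: Rogawski1990, §12.1 p. 171; §12.7 L. 12.7.3 (proof) p. 195] -/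
theorem hiff_chiH2 (ξ : OneDimAutRepH L) (𝓘₂ : (cmBorelTriple L 2 v).IwahoriDatum)
    {K₀₂ : Subgroup ↥(unitaryGroupOfForm (conjLocal L (IsCMField.complexConj L) v) (cmLocalForm L 2 v))}
    {w₂ : ↥(unitaryGroupOfForm (conjLocal L (IsCMField.complexConj L) v) (cmLocalForm L 2 v))}
    (hw₂ : Units.val (w₂ : GL (Fin 2) (LocalRing L v)) = cmLocalForm L 2 v)
    (hnorm : ∀ n, ∀ k ∈ K₀₂, ∀ κ ∈ 𝓘₂.K n, k⁻¹ * κ * k ∈ 𝓘₂.K n) (hw₂K : w₂ ∈ K₀₂) (n : ℕ) :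
    (∀ k : ↥(cmBorelTriple L 2 v).M, (k : ↥(unitaryGroupOfForm (conjLocal L (IsCMField.complexConj L) v) (cmLocalForm L 2 v))) ∈ 𝓘₂.K n →
        (torusCharPair (conjLocal L (IsCMField.complexConj L) v) (cmLocalForm L 2 v) (cmLocalForm_eq_over L 2 v) 0
            ((torusLocalComponent L (IsCMField.complexConj L) v ξ.η).comp
                (quotConj (conjLocal L (IsCMField.complexConj L) v) (conjLocal_conjLocal_cm L v)) *
              halfModulusChar (UnitaryGroup.LocalRing L v))
            (torusLocalComponent L (IsCMField.complexConj L) v ξ.ψ)) k = 1) ↔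
      (∀ k : ↥(cmBorelTriple L 2 v).M, (k : ↥(unitaryGroupOfForm (conjLocal L (IsCMField.complexConj L) v) (cmLocalForm L 2 v))) ∈ 𝓘₂.K n →
        (weylTorusCharPair (conjLocal L (IsCMField.complexConj L) v) (cmLocalForm L 2 v) (cmLocalForm_eq_over L 2 v) 0
            ((torusLocalComponent L (IsCMField.complexConj L) v ξ.η).comp
                (quotConj (conjLocal L (IsCMField.complexConj L) v) (conjLocal_conjLocal_cm L v)) *
              halfModulusChar (UnitaryGroup.LocalRing L v))
            (torusLocalComponent L (IsCMField.complexConj L) v ξ.ψ)) k = 1) :=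
  F0P3cStCharTSDomGeneralH.hiff_of_weylConj₂ L v hw₂ 𝓘₂ hnorm hw₂K n _ _
    fun k => (torusCharPair_cm_weylConj_two L v w₂ hw₂ _ _ k).symm

/-- **(J3) «H-LEVEL-DEEP★» at the CM data.**  For the H-datum `𝓘₂` of `U(Φ₂)(L⁺_v)`, LEVEL-PICK's `(n₀, K₁)` (`K₁ ≤ U(Φ₁)_v` compact open), `ξ ∈ OneDimAutRepH L` and the open kernel of
`ψ_v ∘ det` on `U(Φ₁)_v` (`hψo`, the hypothesis the ★ ST-SHELL-TRACE chain carries): there are `n′` with `𝓘₂.K n′ ≤ 𝓘₂.K n₀` and a compact open subgroup `K₁′ ≤ K₁` with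
`hlev` (`ξ_v = 1` on `K_{2,n′} × K₁′`), `hK₁χ` (`ψ_v ∘ det = 1` on `K₁′`) and `hχlev` (`χ_{H,2} = 1` on `T₂ ∩ K_{2,n′}`) — the three binders of ★ `htr_at_reps` VERBATIM at `(n′, K₁′)`.
(§1 with ★ `exists_nhds_forall_apply_eq_one` for `ξ_v` on the non-archimedean `U(Φ₂)_v × U(Φ₁)_v`, ★ `exists_nhds_forall_subtype_apply_eq_one` for `χ_{H,2}` on `T₂`.)
[cite: Rogawski1990, §12.2 (2) p. 174; §12.7 L. 12.7.3 (proof) p. 195] [cite: TateThesis1967, §2.3] [cite: Casselman1995, Prop. 1.4.4 p. 14] -/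
theorem exists_deep_level_cm (ξ : OneDimAutRepH L) (𝓘₂ : (cmBorelTriple L 2 v).IwahoriDatum) (n₀ : ℕ)
    (K₁ : Subgroup ((cmDatum L 1 (Matrix.of fun i j : Fin 1 => if i.val + j.val + 1 = 1 then (1 : L) else 0)).Local v))
    (hK₁o : IsOpen (K₁ : Set ((cmDatum L 1 (Matrix.of fun i j : Fin 1 => if i.val + j.val + 1 = 1 then (1 : L) else 0)).Local v)))
    (hK₁c : IsCompact (K₁ : Set ((cmDatum L 1 (Matrix.of fun i j : Fin 1 => if i.val + j.val + 1 = 1 then (1 : L) else 0)).Local v)))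
    (hψo : IsOpen (SetLike.coe (MonoidHom.ker ((torusLocalComponent L (IsCMField.complexConj L) v ξ.ψ).comp (localDet (IsCMField.complexConj L) v (isUnit_antidiagOne_det L 1)))))) :
    ∃ (n' : ℕ) (K₁' : Subgroup ((cmDatum L 1 (Matrix.of fun i j : Fin 1 => if i.val + j.val + 1 = 1 then (1 : L) else 0)).Local v)),
      𝓘₂.K n' ≤ 𝓘₂.K n₀ ∧ K₁' ≤ K₁ ∧
      IsOpen (K₁' : Set ((cmDatum L 1 (Matrix.of fun i j : Fin 1 => if i.val + j.val + 1 = 1 then (1 : L) else 0)).Local v)) ∧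
      IsCompact (K₁' : Set ((cmDatum L 1 (Matrix.of fun i j : Fin 1 => if i.val + j.val + 1 = 1 then (1 : L) else 0)).Local v)) ∧
      (∀ x ∈ ((𝓘₂.K n').prod K₁' : Subgroup (↥(unitaryGroupOfForm (conjLocal L (IsCMField.complexConj L) v) (cmLocalForm L 2 v)) ×
          ((cmDatum L 1 (Matrix.of fun i j : Fin 1 => if i.val + j.val + 1 = 1 then (1 : L) else 0)).Local v))), ξ.xiLocalChar v x = 1) ∧
      (∀ k ∈ K₁', ((torusLocalComponent L (IsCMField.complexConj L) v ξ.ψ).comp (localDet (IsCMField.complexConj L) v (isUnit_antidiagOne_det L 1))) k = 1) ∧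
      (∀ k : ↥(cmBorelTriple L 2 v).M, (k : ↥(unitaryGroupOfForm (conjLocal L (IsCMField.complexConj L) v) (cmLocalForm L 2 v))) ∈ 𝓘₂.K n' →
        (torusCharPair (conjLocal L (IsCMField.complexConj L) v) (cmLocalForm L 2 v) (cmLocalForm_eq_over L 2 v) 0
            ((torusLocalComponent L (IsCMField.complexConj L) v ξ.η).comp
                (quotConj (conjLocal L (IsCMField.complexConj L) v) (conjLocal_conjLocal_cm L v)) *
              halfModulusChar (UnitaryGroup.LocalRing L v))
            (torusLocalComponent L (IsCMField.complexConj L) v ξ.ψ)) k = 1) := by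
  haveI h2 : NonarchimedeanGroup ↥(unitaryGroupOfForm (conjLocal L (IsCMField.complexConj L) v) (cmLocalForm L 2 v)) := nonarchimedeanGroup_cmLocal L 2 v
  haveI h2' : NonarchimedeanGroup ((cmDatum L 2 (Matrix.of fun i j : Fin 2 => if i.val + j.val + 1 = 2 then (1 : L) else 0)).Local v) :=
    nonarchimedeanGroup_cmLocal L 2 v
  haveI h1 : NonarchimedeanGroup ((cmDatum L 1 (Matrix.of fun i j : Fin 1 => if i.val + j.val + 1 = 1 then (1 : L) else 0)).Local v) :=
    nonarchimedeanGroup_cmLocal L 1 v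
  haveI : NonarchimedeanGroup ↥(cmBorelTriple L 2 v).M := NonarchimedeanGroup.subgroup _
  -- `ξ_v` is trivial near `1` on `U(Φ₂)_v × U(Φ₁)_v`
  obtain ⟨Vχ, hVχ, hχ⟩ := F0P3cStCharTSCharTrivialNhds.exists_nhds_forall_apply_eq_one (ξ.xiLocalChar v)
    (F0P3cStCharTSXiCont.continuous_unitsHom_of_continuous_val _ (OneDimAutRepH.continuous_xiLocalChar ξ v)).continuousAt
  -- `χ_{H,2}` is trivial near `1` on `T₂`
  obtain ⟨W, hW, hθ⟩ := F0P3cStCharTSCharTrivialNhds.exists_nhds_forall_subtype_apply_eq_one (cmBorelTriple L 2 v).M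
    (torusCharPair (conjLocal L (IsCMField.complexConj L) v) (cmLocalForm L 2 v) (cmLocalForm_eq_over L 2 v) 0
      ((torusLocalComponent L (IsCMField.complexConj L) v ξ.η).comp
          (quotConj (conjLocal L (IsCMField.complexConj L) v) (conjLocal_conjLocal_cm L v)) *
        halfModulusChar (UnitaryGroup.LocalRing L v))
      (torusLocalComponent L (IsCMField.complexConj L) v ξ.ψ))
    (F0P3cStCharTSXiCont.continuous_unitsHom_of_continuous_val _
      (continuous_torusCharPair_apply (conjLocal L (IsCMField.complexConj L) v) (cmLocalForm L 2 v) (cmLocalForm_eq_over L 2 v) 0 _ _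
        (continuous_chiH2_fst L v ξ) (continuous_torusLocalComponent L (IsCMField.complexConj L) (v := v) ξ.ψ))).continuousAt
  -- `ψ_v ∘ det` is trivial on its open kernel
  have hVψ : (SetLike.coe (MonoidHom.ker ((torusLocalComponent L (IsCMField.complexConj L) v ξ.ψ).comp
      (localDet (IsCMField.complexConj L) v (isUnit_antidiagOne_det L 1))))) ∈
      𝓝 (1 : (cmDatum L 1 (Matrix.of fun i j : Fin 1 => if i.val + j.val + 1 = 1 then (1 : L) else 0)).Local v) :=
    hψo.mem_nhds (Subgroup.one_mem _)
  exact exists_deep_level (cmBorelTriple L 2 v) 𝓘₂ n₀ K₁ hK₁o hK₁c (ξ.xiLocalChar v) hVχ hχ _ hW hθ _ hVψ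
    (fun k hk => (MonoidHom.mem_ker).1 hk)

end CM

end Summit.HodgeConjecture.HodgeConjecture.Cruxes.H413.F0P3cStCharTSHLevelDeep

end
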